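import Literature.MathematicalPhysics.QuantumFieldTheory.AnisotropicTwistedPartitionFunction
import Literature.MathematicalPhysics.QuantumFieldTheory.WilsonFinTorusHopfSpectralBound
import Literature.Analysis.OperatorTheory.TwistedKernelTraceFormula
import HarnessLib

/-!
# The temporal vortex ratio at fixed spatial box: light, and eventually non-decreasing in the time extent
# (β-uniform rung 2 of route `VortexVolumeRatchet`, item stmt-QuantumFields-23465 `DyadicVolumeRatchet`)

For a central twist `z` in a TEMPORAL plane `q = (μ, 3)` of the anisotropic box `L_s³ × L_t`,
`Z^{(z)}(L_s, L_t) = Tr Ω[z] 𝕋(L_s)^{L_t}` (`twistedPartitionFunctionAniso_temporal`, `wilsonFinTorusTwistedPartition_eq_integral_iterate`).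
In ONE eigenbasis of the box transfer operator (`exists_eigenbasis_finTorusSliceKernel`): `Z^{(z)}(m+2) = Σᵢ λᵢ^m gᵢ`,
`Z(m+2) = Σᵢ λᵢ^{m+2}`, `|gᵢ| ≤ λᵢ²`, `g_{i₀} = λ_{i₀}²` (flux-free vacuum), and Hopf's gap `λᵢ ≤ τλ_{i₀}` (`i ≠ i₀`,
`τ = tanh(3Nβ L_s³) < 1`, `WilsonFinTorusHopf.abs_eigenvalue_le_tanh_mul`).  So the deficit `n_m = Z(m+2) - Z^{(z)}(m+2) ≥ 0`
contracts, `n_{m+1} ≤ τλ_{i₀} n_m`, while `τ Z(m+2) ≤ λ_{i₀}^{m+2} ≤ Z(m+3)/λ_{i₀}` for large `m`.  Results, for EVERY compact `G`,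
continuous unitary `ρ`, `β ≥ 0`, central `z`, temporal plane, spatial side `L_s`:
* `one_sub_vortexRatio_le_mul_pow` (LIGHT: `1 - t_z(L_s, m+2) ≤ C τ^m`), `tendsto_vortexRatio_atTop` (`t_z(L_s, L_t) → 1`);
* `exists_vortexRatio_le_succ` (RATCHET IN TIME: `t_z(L_s, L_t) ≤ t_z(L_s, L_t+1)` for `L_t ≥ n₀`), `exists_vortexRatio_mono`,
  `exists_vortexRatio_dyadic` (`t_z(L_s, 2^{n+1}) ≤ t_z(L_s, 2^{n+2})`, the crux's letter shape in the time slot).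
This is the time-direction (β-uniform, «easy») instance of the one-doubling handle of `DyadicVolumeRatchet`; the three spatial
doublings carry the crux and are NOT touched.  Finite spatial volume throughout: no mass gap, no area law, no summit is proved;
the Yang–Mills mass gap is NOT proved.
-/

noncomputable section

open MeasureTheory Filter Topology Function
open Literature.MathematicalPhysics.QuantumFieldTheory Literature.Analysis.OperatorTheory

namespace Summit.QuantumFields.YangMills.Theorems.VortexVolumeRatchet.TimeRatchet

/-! ### Arithmetic of the ratchet: a deficit contracting faster than the total -/

section Arithmetic

/-- **One ratchet step.**  If the deficit contracts by `τλ₀` (`n' ≤ τλ₀ n`), the totals dominate the vacuum term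
(`λ₀^{m+3} ≤ d'`) and the total at time `m+2` is `τ`-close to the vacuum term (`τ d ≤ λ₀^{m+2}`), then the ratio does not
decrease: `(d - n)/d ≤ (d' - n')/d'`. [problem-side] -/
theorem ratio_step {lam₀ τ n n' d d' : ℝ} {m : ℕ} (hlam : 0 < lam₀) (hn : 0 ≤ n) (hd : 0 < d) (hd' : 0 < d')
    (hstep : n' ≤ τ * lam₀ * n) (hvac : lam₀ ^ (m + 3) ≤ d') (hclose : τ * d ≤ lam₀ ^ (m + 2)) :
    (d - n) / d ≤ (d' - n') / d' := by
  rw [div_le_div_iff₀ hd hd']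
  have key : n' * d ≤ n * d' := by
    calc n' * d ≤ τ * lam₀ * n * d := mul_le_mul_of_nonneg_right hstep hd.le
      _ = n * (lam₀ * (τ * d)) := by ring
      _ ≤ n * (lam₀ * lam₀ ^ (m + 2)) :=
          mul_le_mul_of_nonneg_left (mul_le_mul_of_nonneg_left hclose hlam.le) hn
      _ = n * lam₀ ^ (m + 3) := by ring
      _ ≤ n * d' := mul_le_mul_of_nonneg_left hvac hn
  nlinarith [key]

/-- **The closeness condition holds eventually**: with `0 ≤ τ < 1`, `0 < λ₀` and a thermal excess decaying like
`d m - λ₀^{m+2} ≤ (τλ₀)^m E`, one has `τ · d m ≤ λ₀^{m+2}` for all large `m`. [problem-side] -/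
theorem eventually_close {lam₀ τ E : ℝ} {d : ℕ → ℝ} (hlam : 0 < lam₀) (hτ0 : 0 ≤ τ) (hτ1 : τ < 1)
    (hexcess : ∀ m, d m - lam₀ ^ (m + 2) ≤ (τ * lam₀) ^ m * E) :
    ∃ m₀ : ℕ, ∀ m, m₀ ≤ m → τ * d m ≤ lam₀ ^ (m + 2) := by
  have hlim : Tendsto (fun m : ℕ => τ ^ (m + 1) * E) atTop (𝓝 0) := by
    have h := (tendsto_pow_atTop_nhds_zero_of_lt_one hτ0 hτ1).comp (tendsto_add_atTop_nat 1)
    simpa using h.mul_const E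
  have hpos : 0 < (1 - τ) * lam₀ ^ 2 := mul_pos (by linarith) (pow_pos hlam 2)
  obtain ⟨m₀, hm₀⟩ := (hlim.eventually (gt_mem_nhds hpos)).exists_forall_of_atTop
  refine ⟨m₀, fun m hm => ?_⟩
  have h1 : τ ^ (m + 1) * E < (1 - τ) * lam₀ ^ 2 := hm₀ m hm
  have hpow : 0 < lam₀ ^ m := pow_pos hlam m
  have h2 : τ * ((τ * lam₀) ^ m * E) ≤ (1 - τ) * lam₀ ^ (m + 2) := by
    have : τ * ((τ * lam₀) ^ m * E) = lam₀ ^ m * (τ ^ (m + 1) * E) := by rw [mul_pow]; ring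
    rw [this, show (1 - τ) * lam₀ ^ (m + 2) = lam₀ ^ m * ((1 - τ) * lam₀ ^ 2) by ring]
    exact mul_le_mul_of_nonneg_left h1.le hpow.le
  calc τ * d m = τ * (d m - lam₀ ^ (m + 2)) + τ * lam₀ ^ (m + 2) := by ring
    _ ≤ τ * ((τ * lam₀) ^ m * E) + τ * lam₀ ^ (m + 2) := by
        gcongr
        exact hexcess m
    _ ≤ (1 - τ) * lam₀ ^ (m + 2) + τ * lam₀ ^ (m + 2) := by linarith [h2]
    _ = lam₀ ^ (m + 2) := by ring

end Arithmetic

/-! ### The spectral bookkeeping of one temporally twisted box -/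

section Spectral

variable {G : Type*} [Group G] [TopologicalSpace G] [IsTopologicalGroup G] [CompactSpace G]
  [MeasurableSpace G] [BorelSpace G] [SecondCountableTopology G] {N : ℕ} (ρ : G →* Matrix (Fin N) (Fin N) ℂ)

/-- **Spectral bookkeeping of the temporally twisted box** `b₁ × b₂ × b₃ × (m+2)` (`β ≥ 0`, continuous unitary `ρ`,
twist family `w` central in the three spatial slots).  With `Z = Z^{(1)}`, `Zʷ = Z^{(w)}` and Hopf's
`τ = tanh(3Nβ·b₁b₂b₃)` there is `λ₀ > 0` (the norm of the transfer operator) with, for every `m`: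
(vacuum) `λ₀^{m+2} ≤ Z(m+2)`; (thermal excess) `Z(m+2) - λ₀^{m+2} ≤ (τλ₀)^m (Z(2) - λ₀²)`;
(deficit sign) `0 ≤ Z(m+2) - Zʷ(m+2)`; (deficit contraction) `Z(m+3) - Zʷ(m+3) ≤ τλ₀ (Z(m+2) - Zʷ(m+2))`.
[problem-side] -/
theorem exists_spectral_bookkeeping (hρ : Continuous ρ) (hρu : ∀ g, ρ g ∈ Matrix.unitaryGroup (Fin N) ℂ)
    {β : ℝ} (hβ : 0 ≤ β) {w : Fin 4 → G} (hw : ∀ i : Fin 3, w i.castSucc ∈ Subgroup.center G) (b₁ b₂ b₃ : ℕ) :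
    ∃ lam₀ : ℝ, 0 < lam₀ ∧
      (∀ m : ℕ, lam₀ ^ (m + 2) ≤ wilsonFinTorusTwistedPartition ρ β 1 b₁ b₂ b₃ (m + 2)) ∧
      (∀ m : ℕ, wilsonFinTorusTwistedPartition ρ β 1 b₁ b₂ b₃ (m + 2) - lam₀ ^ (m + 2) ≤
        (Real.tanh (3 * N * β * ((b₁ : ℝ) * b₂ * b₃)) * lam₀) ^ m *
          (wilsonFinTorusTwistedPartition ρ β 1 b₁ b₂ b₃ 2 - lam₀ ^ 2)) ∧
      (∀ m : ℕ, 0 ≤ wilsonFinTorusTwistedPartition ρ β 1 b₁ b₂ b₃ (m + 2) -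
        wilsonFinTorusTwistedPartition ρ β w b₁ b₂ b₃ (m + 2)) ∧
      (∀ m : ℕ, wilsonFinTorusTwistedPartition ρ β 1 b₁ b₂ b₃ (m + 1 + 2) -
          wilsonFinTorusTwistedPartition ρ β w b₁ b₂ b₃ (m + 1 + 2) ≤
        Real.tanh (3 * N * β * ((b₁ : ℝ) * b₂ * b₃)) * lam₀ *
          (wilsonFinTorusTwistedPartition ρ β 1 b₁ b₂ b₃ (m + 2) -
            wilsonFinTorusTwistedPartition ρ β w b₁ b₂ b₃ (m + 2))) := by
  classical
  haveI : IsFiniteMeasure (haarProbability G) := by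
    dsimp [haarProbability]; infer_instance
  set μ : Measure (FinSpatialSite b₁ b₂ b₃ × Fin 3 → G) :=
    Measure.pi fun _ : FinSpatialSite b₁ b₂ b₃ × Fin 3 => haarProbability G with hμ
  set K : (FinSpatialSite b₁ b₂ b₃ × Fin 3 → G) → (FinSpatialSite b₁ b₂ b₃ × Fin 3 → G) → ℝ :=
    finTorusSliceKernel ρ β with hKdef
  set τ : ℝ := Real.tanh (3 * N * β * ((b₁ : ℝ) * b₂ * b₃)) with hτ
  obtain ⟨C, A, s, hcnt, b, lam, i₀, hC, hA, hb, hlam, hi₀, hL0⟩ :=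
    exists_eigenbasis_finTorusSliceKernel hρ hρu hβ b₁ b₂ b₃
  haveI : Countable s := hcnt
  have hK : StronglyMeasurable (uncurry K) := stronglyMeasurable_uncurry_finTorusSliceKernel ρ hρ β
  have hsymm : ∀ x y, K x y = K y x := finTorusSliceKernel_symm ρ hρu β
  have hKpos : ∀ x y, 0 < K x y := finTorusSliceKernel_pos ρ hρ β
  have hlam0 : ∀ i, 0 ≤ lam i := fun i => (hlam i).1
  have hL0' : 0 < lam i₀ := lt_of_le_of_ne (hlam0 i₀) (Ne.symm hL0)
  set T : (FinSpatialSite b₁ b₂ b₃ × Fin 3 → G) → (FinSpatialSite b₁ b₂ b₃ × Fin 3 → G) := finSliceTwist w with hTdef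
  have hT : MeasurePreserving T μ μ := measurePreserving_finSliceTwist w
  have hKT : ∀ x y, K (T x) (T y) = K x y := fun x y => finTorusSliceKernel_finSliceTwist ρ hw β x y
  set g : s → ℝ := fun i => ∫ x, (∫ z, K (T x) z * b i z ∂μ) * (∫ z, K x z * b i z ∂μ) ∂μ with hg
  have hg_le : ∀ i, |g i| ≤ lam i ^ 2 := fun i => abs_integral_twisted_coeff_le hK hC hA hb hT i
  have hg_top : g i₀ = lam i₀ ^ 2 := integral_twisted_coeff_top hK hC hsymm hKpos hA hb hT hKT hi₀ hL0
  have hHopf : ∀ i, i ≠ i₀ → lam i ≤ τ * lam i₀ := fun i hi => by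
    have h := WilsonFinTorusHopf.abs_eigenvalue_le_tanh_mul (b₁ := b₁) (b₂ := b₂) (b₃ := b₃) ρ hρ hρu hβ hA b hb hi₀ hi
    rw [← hi₀] at h
    exact (le_abs_self _).trans h
  have hτ0 : 0 ≤ τ := by
    rw [hτ, Real.tanh_eq_sinh_div_cosh]
    exact div_nonneg (Real.sinh_nonneg_iff.2 (by positivity)) (Real.cosh_pos _).le
  have hZw : ∀ M : ℕ, HasSum (fun i => lam i ^ M * g i) (wilsonFinTorusTwistedPartition ρ β w b₁ b₂ b₃ (M + 2)) :=
    fun M => by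
    rw [wilsonFinTorusTwistedPartition_eq_integral_iterate ρ hρ β hw b₁ b₂ b₃ M]
    exact hasSum_pow_integral_iterate_twisted hK hC hsymm hA hb hT.measurable M
  have h1c : ∀ i : Fin 3, (1 : Fin 4 → G) i.castSucc ∈ Subgroup.center G := fun i => Subgroup.one_mem _
  have hZ1 : ∀ M : ℕ, HasSum (fun i => lam i ^ M * lam i ^ 2) (wilsonFinTorusTwistedPartition ρ β 1 b₁ b₂ b₃ (M + 2)) :=
    fun M => by
    have h := hasSum_pow_integral_iterate_twisted hK hC hsymm hA hb (T := id) measurable_id M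
    rw [wilsonFinTorusTwistedPartition_eq_integral_iterate ρ hρ β h1c b₁ b₂ b₃ M, finSliceTwist_one]
    simp only [id_eq] at h ⊢
    have hco : ∀ i, ∫ x, (∫ z, K x z * b i z ∂μ) * (∫ z, K x z * b i z ∂μ) ∂μ = lam i ^ 2 := fun i => by
      rw [← integral_sq_integral_kernel_mul_basis hK hC hA hb i]
      exact integral_congr_ae (Eventually.of_forall fun x => (sq _).symm)
    have hfun : (fun i => lam i ^ M * ∫ x, (∫ z, K x z * b i z ∂μ) * (∫ z, K x z * b i z ∂μ) ∂μ) =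
        fun i => lam i ^ M * lam i ^ 2 := funext fun i => by rw [hco]
    rw [hfun] at h
    exact h
  have hn : ∀ M : ℕ, HasSum (fun i => lam i ^ M * (lam i ^ 2 - g i))
      (wilsonFinTorusTwistedPartition ρ β 1 b₁ b₂ b₃ (M + 2) - wilsonFinTorusTwistedPartition ρ β w b₁ b₂ b₃ (M + 2)) :=
    fun M => by
    have h := (hZ1 M).sub (hZw M)
    refine h.congr_fun fun i => ?_
    ring
  have ha0 : ∀ i, 0 ≤ lam i ^ 2 - g i := fun i => by
    have := (abs_le.1 (hg_le i)).2
    linarith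
  have ha_top : lam i₀ ^ 2 - g i₀ = 0 := by rw [hg_top, sub_self]
  refine ⟨lam i₀, hL0', fun m => ?_, fun m => ?_, fun m => ?_, fun m => ?_⟩
  · have h := le_hasSum (hZ1 m) i₀ fun j _ => mul_nonneg (pow_nonneg (hlam0 j) m) (sq_nonneg _)
    exact (by ring : lam i₀ ^ (m + 2) = lam i₀ ^ m * lam i₀ ^ 2) ▸ h
  · set f : s → ℝ := fun i => (τ * lam i₀) ^ m * lam i ^ 2 with hf
    have hfsum : HasSum f ((τ * lam i₀) ^ m * wilsonFinTorusTwistedPartition ρ β 1 b₁ b₂ b₃ 2) := by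
      have h2 := hZ1 0
      simp only [pow_zero, one_mul] at h2
      exact h2.mul_left _
    have hupd := hfsum.update i₀ (lam i₀ ^ m * lam i₀ ^ 2)
    have hle : wilsonFinTorusTwistedPartition ρ β 1 b₁ b₂ b₃ (m + 2) ≤ lam i₀ ^ m * lam i₀ ^ 2 -
        (τ * lam i₀) ^ m * lam i₀ ^ 2 + (τ * lam i₀) ^ m * wilsonFinTorusTwistedPartition ρ β 1 b₁ b₂ b₃ 2 := by
      refine hasSum_le (fun i => ?_) (hZ1 m) hupd
      by_cases hii : i = i₀
      · subst hii; rw [update_self]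
      · rw [update_of_ne hii, hf]
        exact mul_le_mul_of_nonneg_right (pow_le_pow_left₀ (hlam0 i) (hHopf i hii) m) (sq_nonneg _)
    calc wilsonFinTorusTwistedPartition ρ β 1 b₁ b₂ b₃ (m + 2) - lam i₀ ^ (m + 2)
        ≤ lam i₀ ^ m * lam i₀ ^ 2 - (τ * lam i₀) ^ m * lam i₀ ^ 2 +
            (τ * lam i₀) ^ m * wilsonFinTorusTwistedPartition ρ β 1 b₁ b₂ b₃ 2 - lam i₀ ^ (m + 2) := by linarith
      _ = (τ * lam i₀) ^ m * (wilsonFinTorusTwistedPartition ρ β 1 b₁ b₂ b₃ 2 - lam i₀ ^ 2) := by ring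
  · exact (hn m).nonneg fun i => mul_nonneg (pow_nonneg (hlam0 i) m) (ha0 i)
  · have h := hasSum_le (f := fun i => lam i ^ (m + 1) * (lam i ^ 2 - g i))
      (g := fun i => τ * lam i₀ * (lam i ^ m * (lam i ^ 2 - g i))) (fun i => ?_) (hn (m + 1)) ((hn m).mul_left _)
    · exact h
    · by_cases hii : i = i₀
      · subst hii
        simp only [ha_top, mul_zero, le_refl]
      · calc lam i ^ (m + 1) * (lam i ^ 2 - g i) = lam i * (lam i ^ m * (lam i ^ 2 - g i)) := by ring
          _ ≤ τ * lam i₀ * (lam i ^ m * (lam i ^ 2 - g i)) :=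
              mul_le_mul_of_nonneg_right (hHopf i hii) (mul_nonneg (pow_nonneg (hlam0 i) m) (ha0 i))

/-- **The temporal vortex ratio of one box: light with Hopf's rate, and eventually non-decreasing in the time extent.**
For the twist family `w` (central in the spatial slots), `β ≥ 0`, continuous unitary `ρ`, box `b₁ × b₂ × b₃`:
`∃ C ≥ 0, ∀ m, 1 - Zʷ(m+2)/Z(m+2) ≤ C τ^m` (`τ = tanh(3Nβ·b₁b₂b₃)`) and `∃ m₀, ∀ m ≥ m₀, Zʷ(m+2)/Z(m+2) ≤ Zʷ(m+3)/Z(m+3)`.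
[problem-side] -/
theorem twistedRatio_light_and_ratchet (hρ : Continuous ρ) (hρu : ∀ g, ρ g ∈ Matrix.unitaryGroup (Fin N) ℂ)
    {β : ℝ} (hβ : 0 ≤ β) {w : Fin 4 → G} (hw : ∀ i : Fin 3, w i.castSucc ∈ Subgroup.center G) (b₁ b₂ b₃ : ℕ) :
    (∃ C : ℝ, 0 ≤ C ∧ ∀ m : ℕ,
      1 - wilsonFinTorusTwistedPartition ρ β w b₁ b₂ b₃ (m + 2) / wilsonFinTorusTwistedPartition ρ β 1 b₁ b₂ b₃ (m + 2) ≤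
        C * Real.tanh (3 * N * β * ((b₁ : ℝ) * b₂ * b₃)) ^ m) ∧
    (∃ m₀ : ℕ, ∀ m : ℕ, m₀ ≤ m →
      wilsonFinTorusTwistedPartition ρ β w b₁ b₂ b₃ (m + 2) / wilsonFinTorusTwistedPartition ρ β 1 b₁ b₂ b₃ (m + 2) ≤
        wilsonFinTorusTwistedPartition ρ β w b₁ b₂ b₃ (m + 1 + 2) /
          wilsonFinTorusTwistedPartition ρ β 1 b₁ b₂ b₃ (m + 1 + 2)) := by
  set τ : ℝ := Real.tanh (3 * N * β * ((b₁ : ℝ) * b₂ * b₃)) with hτ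
  have hτ0 : 0 ≤ τ := by
    rw [hτ, Real.tanh_eq_sinh_div_cosh]
    exact div_nonneg (Real.sinh_nonneg_iff.2 (by positivity)) (Real.cosh_pos _).le
  have hτ1 : τ < 1 := Real.tanh_lt_one _
  obtain ⟨lam₀, hlam₀, hvac, hexcess, hsign, hstep⟩ := exists_spectral_bookkeeping ρ hρ hρu hβ hw b₁ b₂ b₃
  set d : ℕ → ℝ := fun m => wilsonFinTorusTwistedPartition ρ β 1 b₁ b₂ b₃ (m + 2) with hd
  set n : ℕ → ℝ := fun m => wilsonFinTorusTwistedPartition ρ β 1 b₁ b₂ b₃ (m + 2) -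
    wilsonFinTorusTwistedPartition ρ β w b₁ b₂ b₃ (m + 2) with hndef
  have hdpos : ∀ m, 0 < d m := fun m => lt_of_lt_of_le (pow_pos hlam₀ _) (hvac m)
  have hratio : ∀ m, wilsonFinTorusTwistedPartition ρ β w b₁ b₂ b₃ (m + 2) /
      wilsonFinTorusTwistedPartition ρ β 1 b₁ b₂ b₃ (m + 2) = (d m - n m) / d m := fun m => by
    simp only [hd, hndef, sub_sub_cancel]
  have hgeo : ∀ m, n m ≤ (τ * lam₀) ^ m * n 0 := by
    intro m
    induction m with
    | zero => simp
    | succ m ih =>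
        calc n (m + 1) ≤ τ * lam₀ * n m := hstep m
          _ ≤ τ * lam₀ * ((τ * lam₀) ^ m * n 0) := mul_le_mul_of_nonneg_left ih (mul_nonneg hτ0 hlam₀.le)
          _ = (τ * lam₀) ^ (m + 1) * n 0 := by ring
  refine ⟨⟨n 0 / lam₀ ^ 2, div_nonneg (hsign 0) (sq_nonneg _), fun m => ?_⟩, ?_⟩
  · rw [hratio m]
    have hpow : 0 < lam₀ ^ (m + 2) := pow_pos hlam₀ _
    have hdne : d m ≠ 0 := (hdpos m).ne'
    have hlne : lam₀ ≠ 0 := hlam₀.ne'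
    calc 1 - (d m - n m) / d m = n m / d m := by field_simp; ring
      _ ≤ n m / lam₀ ^ (m + 2) := div_le_div_of_nonneg_left (hsign m) hpow (hvac m)
      _ ≤ (τ * lam₀) ^ m * n 0 / lam₀ ^ (m + 2) := div_le_div_of_nonneg_right (hgeo m) hpow.le
      _ = n 0 / lam₀ ^ 2 * τ ^ m := by rw [mul_pow]; field_simp; ring
  · obtain ⟨m₀, hm₀⟩ := eventually_close (d := d) hlam₀ hτ0 hτ1 hexcess
    refine ⟨m₀, fun m hm => ?_⟩
    rw [hratio m, show m + 1 + 2 = (m + 1) + 2 from rfl, hratio (m + 1)]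
    exact ratio_step (m := m) hlam₀ (hsign m) (hdpos m) (hdpos (m + 1)) (hstep m)
      (by simpa [hd, show m + 1 + 2 = m + 3 by ring] using hvac (m + 1)) (hm₀ m hm)

end Spectral

/-! ### The anisotropic single-plane vortex ratio in a temporal plane -/

section Aniso

variable {G : Type*} [Group G] [TopologicalSpace G] [IsTopologicalGroup G] [CompactSpace G]
  [MeasurableSpace G] [BorelSpace G] [SecondCountableTopology G] {N : ℕ} (ρ : G →* Matrix (Fin N) (Fin N) ℂ)

omit [TopologicalSpace G] [IsTopologicalGroup G] [CompactSpace G] [MeasurableSpace G] [BorelSpace G]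
  [SecondCountableTopology G] in
/-- A single-plane temporal twist by a central element is a twist family central in the spatial slots. [problem-side] -/
theorem mulSingle_castSucc_mem_center {z : G} (hz : z ∈ Subgroup.center G) (μ : Fin 4) (i : Fin 3) :
    (Pi.mulSingle μ z : Fin 4 → G) i.castSucc ∈ Subgroup.center G := by
  classical
  rw [Pi.mulSingle_apply]
  split_ifs
  · exact hz
  · exact Subgroup.one_mem _

omit [SecondCountableTopology G] in
/-- The untwisted anisotropic partition function is the member `w = 1` of the temporally twisted family. [problem-side] -/
theorem twistedPartitionFunctionAniso_one_eq (β : ℝ) (Ls Lt : ℕ) (q : {p : Fin 4 × Fin 4 // p.1 < p.2}) :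
    twistedPartitionFunctionAniso ρ β Ls Lt (1 : G) q = wilsonFinTorusTwistedPartition ρ β 1 Ls Ls Ls Lt := by
  rw [twistedPartitionFunctionAniso_one, wilsonFinTorusTwistedPartition_one]

/-- **LIGHT TEMPORAL VORTEX AT FIXED SPATIAL BOX, with Hopf's rate.**  `β ≥ 0`, continuous unitary `ρ`, central `z`,
temporal plane `q = (μ, 3)`, spatial side `L_s`: there is `C = C(G, ρ, β, z, q, L_s) ≥ 0` with
`1 - Z_z(L_s, m+2)/Z_1(L_s, m+2) ≤ C · tanh(3Nβ L_s³)^m` for every `m`. [problem-side] -/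
theorem one_sub_vortexRatio_le_mul_pow (hρ : Continuous ρ) (hρu : ∀ g, ρ g ∈ Matrix.unitaryGroup (Fin N) ℂ)
    {β : ℝ} (hβ : 0 ≤ β) {z : G} (hz : z ∈ Subgroup.center G) (q : {p : Fin 4 × Fin 4 // p.1 < p.2})
    (hq : q.1.2 = 3) (Ls : ℕ) :
    ∃ C : ℝ, 0 ≤ C ∧ ∀ m : ℕ,
      1 - twistedPartitionFunctionAniso ρ β Ls (m + 2) z q / twistedPartitionFunctionAniso ρ β Ls (m + 2) 1 q ≤
        C * Real.tanh (3 * N * β * ((Ls : ℝ) * Ls * Ls)) ^ m := by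
  obtain ⟨⟨C, hC0, hC⟩, -⟩ := twistedRatio_light_and_ratchet ρ hρ hρu hβ
    (mulSingle_castSucc_mem_center hz q.1.1) Ls Ls Ls
  refine ⟨C, hC0, fun m => ?_⟩
  rw [twistedPartitionFunctionAniso_temporal ρ β Ls (m + 2) z q hq, twistedPartitionFunctionAniso_one_eq]
  exact hC m

/-- **A central temporal twist never raises the partition function**: `Z_z(L_s, m+2) ≤ Z_1(L_s, m+2)` (the deficit
`Σ_{i ≠ i₀} λᵢ^m (λᵢ² - gᵢ)` is non-negative). [problem-side] -/
theorem vortex_le_untwisted (hρ : Continuous ρ) (hρu : ∀ g, ρ g ∈ Matrix.unitaryGroup (Fin N) ℂ)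
    {β : ℝ} (hβ : 0 ≤ β) {z : G} (hz : z ∈ Subgroup.center G) (q : {p : Fin 4 × Fin 4 // p.1 < p.2})
    (hq : q.1.2 = 3) (Ls m : ℕ) :
    twistedPartitionFunctionAniso ρ β Ls (m + 2) z q ≤ twistedPartitionFunctionAniso ρ β Ls (m + 2) 1 q := by
  obtain ⟨-, -, -, -, hsign, -⟩ := exists_spectral_bookkeeping ρ hρ hρu hβ
    (mulSingle_castSucc_mem_center hz q.1.1) Ls Ls Ls
  rw [twistedPartitionFunctionAniso_temporal ρ β Ls (m + 2) z q hq, twistedPartitionFunctionAniso_one_eq]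
  linarith [hsign m]

/-- The temporal vortex ratio lies in `(0, 1]`: positivity. [problem-side] -/
theorem vortexRatio_pos (hρ : Continuous ρ) (β : ℝ) (z : G) (q : {p : Fin 4 × Fin 4 // p.1 < p.2}) (Ls Lt : ℕ) :
    0 < twistedPartitionFunctionAniso ρ β Ls Lt z q / twistedPartitionFunctionAniso ρ β Ls Lt 1 q :=
  div_pos (twistedPartitionFunctionAniso_pos ρ hρ β Ls Lt z q) (twistedPartitionFunctionAniso_pos ρ hρ β Ls Lt 1 q)

/-- The temporal vortex ratio lies in `(0, 1]`: the upper bound (time extent `≥ 2`). [problem-side] -/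
theorem vortexRatio_le_one (hρ : Continuous ρ) (hρu : ∀ g, ρ g ∈ Matrix.unitaryGroup (Fin N) ℂ)
    {β : ℝ} (hβ : 0 ≤ β) {z : G} (hz : z ∈ Subgroup.center G) (q : {p : Fin 4 × Fin 4 // p.1 < p.2})
    (hq : q.1.2 = 3) (Ls m : ℕ) :
    twistedPartitionFunctionAniso ρ β Ls (m + 2) z q / twistedPartitionFunctionAniso ρ β Ls (m + 2) 1 q ≤ 1 := by
  rw [div_le_one (twistedPartitionFunctionAniso_pos ρ hρ β Ls (m + 2) 1 q)]
  exact vortex_le_untwisted ρ hρ hρu hβ hz q hq Ls m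

/-- **The temporal vortex ratio tends to `1` as the time extent grows** (fixed spatial box, every `β ≥ 0`): no temporal
centre vortex is heavy at finite spatial volume. [problem-side] -/
theorem tendsto_vortexRatio_atTop (hρ : Continuous ρ) (hρu : ∀ g, ρ g ∈ Matrix.unitaryGroup (Fin N) ℂ)
    {β : ℝ} (hβ : 0 ≤ β) {z : G} (hz : z ∈ Subgroup.center G) (q : {p : Fin 4 × Fin 4 // p.1 < p.2})
    (hq : q.1.2 = 3) (Ls : ℕ) :
    Tendsto (fun Lt : ℕ => twistedPartitionFunctionAniso ρ β Ls Lt z q / twistedPartitionFunctionAniso ρ β Ls Lt 1 q)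
      atTop (𝓝 1) := by
  set τ : ℝ := Real.tanh (3 * N * β * ((Ls : ℝ) * Ls * Ls)) with hτ
  have hτ0 : 0 ≤ τ := by
    rw [hτ, Real.tanh_eq_sinh_div_cosh]
    exact div_nonneg (Real.sinh_nonneg_iff.2 (by positivity)) (Real.cosh_pos _).le
  have hτ1 : τ < 1 := Real.tanh_lt_one _
  obtain ⟨C, -, hC⟩ := one_sub_vortexRatio_le_mul_pow ρ hρ hρu hβ hz q hq Ls
  rw [← tendsto_add_atTop_iff_nat 2]
  have hlow : Tendsto (fun m : ℕ => 1 - C * τ ^ m) atTop (𝓝 1) := by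
    have h := ((tendsto_pow_atTop_nhds_zero_of_lt_one hτ0 hτ1).const_mul C).const_sub 1
    simpa using h
  refine tendsto_of_tendsto_of_tendsto_of_le_of_le hlow tendsto_const_nhds (fun m => ?_) fun m => ?_
  · have := hC m
    simp only
    linarith
  · exact vortexRatio_le_one ρ hρ hρu hβ hz q hq Ls m

/-- **RATCHET IN TIME**: at fixed spatial box the temporal vortex ratio is eventually non-decreasing in the time extent,
`∃ n₀, ∀ L_t ≥ n₀, t_z(L_s, L_t) ≤ t_z(L_s, L_t + 1)` — every compact `G`, continuous unitary `ρ`, `β ≥ 0`, central `z`,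
temporal plane. [problem-side] -/
theorem exists_vortexRatio_le_succ (hρ : Continuous ρ) (hρu : ∀ g, ρ g ∈ Matrix.unitaryGroup (Fin N) ℂ)
    {β : ℝ} (hβ : 0 ≤ β) {z : G} (hz : z ∈ Subgroup.center G) (q : {p : Fin 4 × Fin 4 // p.1 < p.2})
    (hq : q.1.2 = 3) (Ls : ℕ) :
    ∃ n₀ : ℕ, ∀ Lt : ℕ, n₀ ≤ Lt →
      twistedPartitionFunctionAniso ρ β Ls Lt z q / twistedPartitionFunctionAniso ρ β Ls Lt 1 q ≤
        twistedPartitionFunctionAniso ρ β Ls (Lt + 1) z q / twistedPartitionFunctionAniso ρ β Ls (Lt + 1) 1 q := by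
  obtain ⟨-, m₀, hm₀⟩ := twistedRatio_light_and_ratchet ρ hρ hρu hβ (mulSingle_castSucc_mem_center hz q.1.1) Ls Ls Ls
  refine ⟨m₀ + 2, fun Lt hLt => ?_⟩
  obtain ⟨m, rfl⟩ : ∃ m, Lt = m + 2 := ⟨Lt - 2, by omega⟩
  rw [twistedPartitionFunctionAniso_temporal ρ β Ls (m + 2) z q hq, twistedPartitionFunctionAniso_one_eq,
    show m + 2 + 1 = m + 1 + 2 by ring,
    twistedPartitionFunctionAniso_temporal ρ β Ls (m + 1 + 2) z q hq, twistedPartitionFunctionAniso_one_eq]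
  exact hm₀ m (by omega)

/-- **Eventually monotone**: `∃ n₀, ∀ n₀ ≤ L_t ≤ L_t', t_z(L_s, L_t) ≤ t_z(L_s, L_t')`. [problem-side] -/
theorem exists_vortexRatio_mono (hρ : Continuous ρ) (hρu : ∀ g, ρ g ∈ Matrix.unitaryGroup (Fin N) ℂ)
    {β : ℝ} (hβ : 0 ≤ β) {z : G} (hz : z ∈ Subgroup.center G) (q : {p : Fin 4 × Fin 4 // p.1 < p.2})
    (hq : q.1.2 = 3) (Ls : ℕ) :
    ∃ n₀ : ℕ, ∀ Lt Lt' : ℕ, n₀ ≤ Lt → Lt ≤ Lt' →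
      twistedPartitionFunctionAniso ρ β Ls Lt z q / twistedPartitionFunctionAniso ρ β Ls Lt 1 q ≤
        twistedPartitionFunctionAniso ρ β Ls Lt' z q / twistedPartitionFunctionAniso ρ β Ls Lt' 1 q := by
  obtain ⟨n₀, h⟩ := exists_vortexRatio_le_succ ρ hρ hρu hβ hz q hq Ls
  refine ⟨n₀, fun Lt Lt' hLt hle => ?_⟩
  induction Lt', hle using Nat.le_induction with
  | base => exact le_rfl
  | succ k hk ih => exact ih.trans (h k (hLt.trans hk))

/-- **Dyadic time ratchet** in the letter shape of the crux: `∃ n₀, ∀ n ≥ n₀, t_z(L_s, 2^{n+1}) ≤ t_z(L_s, 2^{n+2})`.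
[problem-side] -/
theorem exists_vortexRatio_dyadic (hρ : Continuous ρ) (hρu : ∀ g, ρ g ∈ Matrix.unitaryGroup (Fin N) ℂ)
    {β : ℝ} (hβ : 0 ≤ β) {z : G} (hz : z ∈ Subgroup.center G) (q : {p : Fin 4 × Fin 4 // p.1 < p.2})
    (hq : q.1.2 = 3) (Ls : ℕ) :
    ∃ n₀ : ℕ, ∀ n : ℕ, n₀ ≤ n →
      twistedPartitionFunctionAniso ρ β Ls (2 ^ (n + 1)) z q / twistedPartitionFunctionAniso ρ β Ls (2 ^ (n + 1)) 1 q ≤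
        twistedPartitionFunctionAniso ρ β Ls (2 ^ (n + 2)) z q /
          twistedPartitionFunctionAniso ρ β Ls (2 ^ (n + 2)) 1 q := by
  obtain ⟨n₀, h⟩ := exists_vortexRatio_mono ρ hρ hρu hβ hz q hq Ls
  refine ⟨n₀, fun n hn => h _ _ ?_ ?_⟩
  · calc n₀ ≤ n := hn
      _ ≤ n + 1 := Nat.le_succ n
      _ ≤ 2 ^ (n + 1) := (Nat.lt_two_pow_self).le
  · exact Nat.pow_le_pow_right (by norm_num) (by omega)

end Aniso

/-! ### The symmetric torus on the diagonal -/

section Symmetric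

variable {G : Type*} [Group G] [TopologicalSpace G] [IsTopologicalGroup G] [CompactSpace G]
  [MeasurableSpace G] [BorelSpace G] [SecondCountableTopology G] {N : ℕ} (ρ : G →* Matrix (Fin N) (Fin N) ℂ)

omit [SecondCountableTopology G] in
/-- The crux's symmetric-torus vortex ratio `t_z(L) = Z_z(L)/Z_1(L)` is the diagonal value `t_z(L, L)` of the
two-parameter family studied here (bridge `twistedPartitionFunctionAniso_self`); the ratchet above moves OFF the
diagonal in the time direction only. [problem-side] -/
theorem vortexRatio_symmetric_eq_aniso (β : ℝ) (z : G) (q : {p : Fin 4 × Fin 4 // p.1 < p.2}) (L : ℕ) [NeZero L] :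
    twistedPartitionFunction ρ β L z q / twistedPartitionFunction ρ β L 1 q =
      twistedPartitionFunctionAniso ρ β L L z q / twistedPartitionFunctionAniso ρ β L L 1 q := by
  rw [twistedPartitionFunction_eq_aniso, twistedPartitionFunction_eq_aniso]

end Symmetric

end Summit.QuantumFields.YangMills.Theorems.VortexVolumeRatchet.TimeRatchet

end
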